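import Summits.AtomisticToContinuum.Crystallization.Theorems.ChartedZeroExcessLayeredLatticeLiouvilleTV
import Summits.AtomisticToContinuum.Crystallization.Theorems.PalmUnimodularRigidityShellsToBarlowChartCubicGrowthAngle

/-!
# Zero-excess layered lattice Liouville — part TW (lens-2 g42/g43, towards K_F): the sub-unit covering radius, the bump, local counts

Groundwork for the proof of `FieldRigidityP` (part TV, XXII.2) by the smooth partition-of-unity interpolant (parts TX–TY): three energy-free,
chart-free facts about `aHi`-clean `δ`-separated configurations (`aHi ≤ 8/7`) and one fixed smooth bump.

* XXIII.1 ★ COVERING RADIUS `< 9/10` (PROVED): every point of space is within distance `< 9/10` of a nonempty `δ`-separated `aHi`-clean set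
  (`exists_mem_dist_lt_nine_tenths_of_cleanP`; record `exists_mem_dist_lt_five_of_cleanP` had `5`).  The descent step uses the `45°` covering
  angle of the FIRST shell (`fcc_coveringAngle` / `hcp_coveringAngle`: `‖u‖ ≤ √2·⟪u, v⟫` for a kissing vector `v`, `‖v‖ = 1`) instead of the
  two-shell bound `⟪u, v⟫ ≥ ‖u‖/2`: from an atom `y` with `dist x y ≥ 9/10` the matched neighbour `f v` of `y` in the direction of `x − y` is
  strictly closer to `x` (`(255/448 + D/16)² < D²/2` for `D ≥ 9/10`).  Window form: every `y` with `‖y‖ < R − 9/10` has a window site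
  `x ∈ win R` with `dist y x < 9/10`.
* XXIII.2 THE BUMP (PROVED): one fixed smooth `φ₀ : E3 → ℝ` (Mathlib `ContDiffBump` at `0`, radii `1 < 17/16`): `0 ≤ φ₀ ≤ 1`, `φ₀ = 1` on the
  closed unit ball, `φ₀ = 0` off the open ball of radius `17/16`, `C^∞`, and its derivative is bounded: `∃ M, ∀ y, ‖fderiv ℝ φ₀ y‖ ≤ M`;
  translates `y ↦ φ₀ (y − x)` with their derivatives.
* XXIII.3 LOCAL COUNTS (PROVED): a `δ`-separated finite set has at most `(2r/δ + 1)³` members within distance `r` of any point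
  (`card_filter_dist_le_le`), and the power-mean step `(Σ_{s} b)³ ≤ (#s)²·Σ_{s} b³` is part TU's `sum_pow_three_le_card_sq_mul_sum`.

No `sorry`, no new axioms, no type-class declarations, no custom syntax, no option pragmas.  ENERGY-FREE, θ-FREE.
-/

noncomputable section

open scoped BigOperators RealInnerProductSpace
open MeasureTheory Set Metric Filter Topology
open Summit.AtomisticToContinuum.Crystallization.Theorems.ChartedPlanarOrderRigidityDoor (E3 atomsIn)
open Summit.AtomisticToContinuum.Crystallization.Theorems.ChartedPlanarOrderDensityDichotomy (μS IsSep nK nK_nonneg)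
open Summit.AtomisticToContinuum.Crystallization.Theorems.ChartedPlanarOrderCleanScaleP (IsCleanP IsDoorSetP isCleanP_μS_iff)
open Summit.AtomisticToContinuum.Crystallization.Theorems.ChartedPlanarOrderCleanStackedIndependent (setOf_μS_ne_zero finite_sep_inter_closedBall)
open Summit.AtomisticToContinuum.Crystallization.Theorems.PalmUnimodularRigidityShellsToBarlowChart (fcc_coveringAngle hcp_coveringAngle)
open Literature.MathematicalPhysics.StatisticalMechanics (card_le_of_separated_of_dist_le)
open Literature.Geometry.DiscreteGeometry (IsTwoShellGoodSet fccTwoShellPattern hcpTwoShellPattern fccKissingPattern hcpKissingPattern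
  fccKissingPattern_subset hcpKissingPattern_subset norm_eq_one_of_mem_fccKissingPattern norm_eq_one_of_mem_hcpKissingPattern)

namespace Summit.AtomisticToContinuum.Crystallization.Theorems.ChartedZeroExcessLayeredLatticeLiouville

/-! ### XXIII.1 Covering radius `< 9/10` of clean configurations -/

section Covering

variable {δ aHi : ℝ} {S : Set E3}

/-- the `45°` covering angle of either two-shell pattern's FIRST shell: a unit pattern vector `v` with `‖u‖ ≤ √2·⟪u, v⟫`. -/
theorem exists_unit_inner_ge_of_pattern {P : Finset E3} (hP : P = fccTwoShellPattern ∨ P = hcpTwoShellPattern) (u : E3) :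
    ∃ v ∈ P, ‖v‖ = 1 ∧ ‖u‖ ≤ Real.sqrt 2 * ⟪u, v⟫ := by
  rcases hP with rfl | rfl
  · obtain ⟨v, hv, h⟩ := fcc_coveringAngle u
    exact ⟨v, fccKissingPattern_subset hv, norm_eq_one_of_mem_fccKissingPattern hv, h⟩
  · obtain ⟨v, hv, h⟩ := hcp_coveringAngle u
    exact ⟨v, hcpKissingPattern_subset hv, norm_eq_one_of_mem_hcpKissingPattern hv, h⟩

/-- the descent arithmetic: with `t ≥ 0`, `D² ≤ 2t²` (the `45°` angle), `9/10 ≤ D`, `9/10 ≤ a ≤ 8/7`, the point `y + a•Av` is closer to `x` than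
`D − a/16`: `D² − 2·a·t + a² < (D − a/16)²`. -/
theorem covering_descent_ineq {a D t : ℝ} (ha1 : 9 / 10 ≤ a) (ha2 : a ≤ 8 / 7) (hD : 9 / 10 ≤ D) (ht : 0 ≤ t) (hDt : D ^ 2 ≤ 2 * t ^ 2) :
    D ^ 2 - 2 * a * t + a ^ 2 < (D - a / 16) ^ 2 := by
  -- it suffices that `t > 255/448 + D/16 =: m`, which follows from `m² < D²/2 ≤ t²`
  have hm0 : 0 < 255 / 448 + D / 16 := by linarith
  have hm2 : (255 / 448 + D / 16) ^ 2 < t ^ 2 := by nlinarith [mul_nonneg (sub_nonneg.2 hD) (sub_nonneg.2 hD), sub_nonneg.2 hD]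
  have hmt : 255 / 448 + D / 16 < t := by
    by_contra h
    push Not at h
    have := mul_self_le_mul_self ht h
    nlinarith
  have ha0 : 0 < a := by linarith
  nlinarith [mul_lt_mul_of_pos_left hmt ha0, mul_le_mul_of_nonneg_left ha2 ha0.le]

/-- ★ the clean descent step at radius `9/10`: from an atom `y` of an `aHi`-clean set (`aHi ≤ 8/7`) at distance `≥ 9/10` from `x`, some first-shell
neighbour of `y` is strictly closer to `x`. -/
theorem exists_closer_of_cleanP_nine_tenths (haHi : aHi ≤ 8 / 7) (hC : IsCleanP aHi (μS S)) {x y : E3} (hy : y ∈ S)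
    (hfar : 9 / 10 ≤ dist x y) : ∃ z ∈ S, dist x z < dist x y := by
  have hy' : μS S {y} ≠ 0 := (Literature.Probability.Process.count_restrict_singleton_ne_zero_iff S y).2 hy
  obtain ⟨a, ha1, ha2, A, P, f, hP, hf, -, -⟩ := hC y hy'
  rw [setOf_μS_ne_zero] at hf
  set Ae := A.toLinearIsometryEquiv rfl with hAe
  set d : E3 := x - y with hd
  obtain ⟨v, hvP, hv1, hv⟩ := exists_unit_inner_ge_of_pattern hP (Ae.symm d)
  have hAd : A (Ae.symm d) = d := by
    have h := LinearIsometryEquiv.apply_symm_apply Ae d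
    rw [hAe, LinearIsometry.toLinearIsometryEquiv_apply] at h
    rw [hAe]
    exact h
  have hAv : ⟪d, A v⟫ = ⟪Ae.symm d, v⟫ := by rw [← A.inner_map_map (Ae.symm d) v, hAd]
  rw [LinearIsometryEquiv.norm_map] at hv
  have hD : ‖d‖ = dist x y := by rw [hd, dist_eq_norm]
  have ha87 : a ≤ 8 / 7 := ha2.trans haHi
  have ha0 : 0 < a := by linarith
  set t : ℝ := ⟪d, A v⟫ with ht
  have htv : ‖d‖ ≤ Real.sqrt 2 * t := by rw [hAv]; exact hv
  have ht0 : 0 ≤ t := by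
    have h2 : 0 < Real.sqrt 2 := by positivity
    nlinarith [norm_nonneg d]
  have hDt : ‖d‖ ^ 2 ≤ 2 * t ^ 2 := by
    have h := mul_self_le_mul_self (norm_nonneg d) htv
    have hs : Real.sqrt 2 * Real.sqrt 2 = 2 := Real.mul_self_sqrt (by norm_num)
    nlinarith
  obtain ⟨hz, hzd⟩ := hf v hvP
  refine ⟨f v, hz, ?_⟩
  have hsq : dist x (y + a • A v) ^ 2 = ‖d‖ ^ 2 - 2 * a * t + a ^ 2 := by
    rw [dist_eq_norm, show x - (y + a • A v) = d - a • A v by rw [hd]; abel, norm_sub_sq_real, real_inner_smul_right, norm_smul,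
      A.norm_map, hv1, Real.norm_eq_abs, abs_of_pos ha0, ← ht]
    ring
  have hlt : dist x (y + a • A v) ^ 2 < (dist x y - a / 16) ^ 2 := by
    rw [hsq, hD]
    exact covering_descent_ineq ha1 ha87 hfar ht0 (hD ▸ hDt)
  have hpos : 0 ≤ dist x y - a / 16 := by linarith
  have hmid : dist x (y + a • A v) < dist x y - a / 16 := lt_of_pow_lt_pow_left₀ 2 hpos hlt
  calc dist x (f v) ≤ dist x (y + a • A v) + dist (y + a • A v) (f v) := dist_triangle _ _ _
    _ < dist x y - a / 16 + 1 / 16 * a := by rw [dist_comm (y + a • A v)]; exact add_lt_add_of_lt_of_le hmid hzd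
    _ = dist x y := by ring

/-- ★ COVERING RADIUS `< 9/10`: a separated, nonempty, `aHi`-clean set (`aHi ≤ 8/7`) meets every open ball of radius `9/10`. -/
theorem exists_mem_dist_lt_nine_tenths_of_cleanP (haHi : aHi ≤ 8 / 7) (hδ : 0 < δ) (hS : IsSep δ S) (hC : IsCleanP aHi (μS S))
    (hne : S.Nonempty) (x : E3) : ∃ y ∈ S, dist x y < 9 / 10 := by
  obtain ⟨y₁, hy₁⟩ := hne
  set F := S ∩ closedBall x (dist x y₁) with hF
  have hFfin : F.Finite := finite_sep_inter_closedBall hδ hS x _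
  have hFne : F.Nonempty := ⟨y₁, hy₁, by rw [mem_closedBall, dist_comm]⟩
  obtain ⟨y, hyF, hmin⟩ := Set.exists_min_image F (fun y => dist x y) hFfin hFne
  refine ⟨y, hyF.1, ?_⟩
  by_contra hfar
  push Not at hfar
  obtain ⟨z, hz, hzd⟩ := exists_closer_of_cleanP_nine_tenths haHi hC hyF.1 hfar
  have hzF : z ∈ F := by
    refine ⟨hz, ?_⟩
    rw [mem_closedBall, dist_comm]
    have := hmin y₁ ⟨hy₁, by rw [mem_closedBall, dist_comm]⟩
    linarith
  have := hmin z hzF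
  linarith

/-- WINDOW FORM: on an `aHi`-door set, every point `y` with `‖y‖ < R − 9/10` is within `< 9/10` of a window site `x ∈ win R`
(so `‖y − x‖ ≤ 1`: the bump centred at `x` equals `1` at `y`). -/
theorem exists_atomsIn_dist_lt_of_doorP (haHi : aHi ≤ 8 / 7) (hδ : 0 < δ) (hS : IsDoorSetP aHi δ S) {R : ℝ} {y : E3}
    (hy : ‖y‖ < R - 9 / 10) : ∃ x ∈ atomsIn (μS S) 0 R, dist y x < 9 / 10 := by
  obtain ⟨x, hxS, hxy⟩ := exists_mem_dist_lt_nine_tenths_of_cleanP haHi hδ hS.2.1 hS.2.2.1 ⟨0, hS.1⟩ y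
  refine ⟨x, mem_atomsIn_iff.2 ⟨hxS, ?_⟩, hxy⟩
  have h1 : ‖x‖ ≤ ‖y‖ + dist y x := by
    have := norm_le_norm_add_norm_sub' x y  -- ‖x‖ ≤ ‖y‖ + ‖x - y‖
    rw [dist_eq_norm, norm_sub_rev]; exact this
  linarith

end Covering

/-! ### XXIII.2 The bump `φ₀` -/

section Bump

/-- the fixed bump datum: centre `0`, inner radius `1`, outer radius `17/16`. -/
def bump₀ : ContDiffBump (0 : E3) := ⟨1, 17 / 16, one_pos, by norm_num⟩

/-- ★ the fixed smooth bump `φ₀ : E3 → ℝ`. -/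
def φ₀ : E3 → ℝ := bump₀

/-- the bump is nonnegative. [this file] -/
theorem φ₀_nonneg (y : E3) : 0 ≤ φ₀ y := bump₀.nonneg

/-- the bump is at most one. [this file] -/
theorem φ₀_le_one (y : E3) : φ₀ y ≤ 1 := bump₀.le_one

/-- `φ₀ = 1` on the closed unit ball. -/
theorem φ₀_eq_one_of_norm_le_one {y : E3} (hy : ‖y‖ ≤ 1) : φ₀ y = 1 :=
  bump₀.one_of_mem_closedBall (by simpa [bump₀] using hy)

/-- `φ₀ = 0` off the open ball of radius `17/16`. -/
theorem φ₀_eq_zero_of_le_norm {y : E3} (hy : 17 / 16 ≤ ‖y‖) : φ₀ y = 0 :=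
  bump₀.zero_of_le_dist (by simpa [bump₀] using hy)

/-- contrapositive: where `φ₀ ≠ 0` the argument has norm `< 17/16`. -/
theorem norm_lt_of_φ₀_ne_zero {y : E3} (hy : φ₀ y ≠ 0) : ‖y‖ < 17 / 16 := by
  by_contra h
  exact hy (φ₀_eq_zero_of_le_norm (not_lt.1 h))

/-- the bump is smooth. [this file] -/
theorem φ₀_contDiff {n : ℕ∞} : ContDiff ℝ n φ₀ := bump₀.contDiff

/-- the bump is differentiable. [this file] -/
theorem φ₀_differentiable : Differentiable ℝ φ₀ := (φ₀_contDiff (n := 1)).differentiable (by simp)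

/-- the bump has compact support. [this file] -/
theorem φ₀_hasCompactSupport : HasCompactSupport φ₀ := bump₀.hasCompactSupport

/-- the bump has a continuous derivative. [this file] -/
theorem φ₀_continuous_fderiv : Continuous (fderiv ℝ φ₀) := (φ₀_contDiff (n := 1)).continuous_fderiv (by simp)

/-- ★ the derivative of the bump is bounded (a continuous function of compact support). -/
theorem exists_bound_fderiv_φ₀ : ∃ M : ℝ, 0 ≤ M ∧ ∀ y : E3, ‖fderiv ℝ φ₀ y‖ ≤ M := by
  obtain ⟨C, hC⟩ := (φ₀_hasCompactSupport.fderiv (𝕜 := ℝ)).exists_bound_of_continuous φ₀_continuous_fderiv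
  exact ⟨max C 0, le_max_right _ _, fun y => (hC y).trans (le_max_left _ _)⟩

/-- the translated bump `y ↦ φ₀ (y − x)` and its derivative. -/
theorem hasFDerivAt_φ₀_sub (x y : E3) : HasFDerivAt (fun y => φ₀ (y - x)) (fderiv ℝ φ₀ (y - x)) y := by
  have h := (φ₀_differentiable (y - x)).hasFDerivAt.comp y (hasFDerivAt_sub_const x)
  rwa [ContinuousLinearMap.comp_id] at h

/-- derivative of the translated bump. [this file] -/
theorem fderiv_φ₀_sub (x y : E3) : fderiv ℝ (fun y => φ₀ (y - x)) y = fderiv ℝ φ₀ (y - x) := (hasFDerivAt_φ₀_sub x y).fderiv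

/-- the translated bump is differentiable. [this file] -/
theorem differentiable_φ₀_sub (x : E3) : Differentiable ℝ (fun y => φ₀ (y - x)) := fun y => (hasFDerivAt_φ₀_sub x y).differentiableAt

/-- the translated bump is smooth. [this file] -/
theorem contDiff_φ₀_sub (x : E3) {n : ℕ∞} : ContDiff ℝ n (fun y => φ₀ (y - x)) := φ₀_contDiff.comp (contDiff_id.sub contDiff_const)

/-- the translated bump is `1` on the closed unit ball about `x` and vanishes off the open `17/16`-ball about `x`. -/
theorem φ₀_sub_eq_one_of_dist_le {x y : E3} (h : dist y x ≤ 1) : φ₀ (y - x) = 1 := φ₀_eq_one_of_norm_le_one (by rwa [← dist_eq_norm])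

/-- the translated bump vanishes outside radius `17/16` about `x`. [this file] -/
theorem φ₀_sub_eq_zero_of_le_dist {x y : E3} (h : 17 / 16 ≤ dist y x) : φ₀ (y - x) = 0 := φ₀_eq_zero_of_le_norm (by rwa [← dist_eq_norm])

/-- where the translated bump is nonzero the point is within `17/16` of `x`. [this file] -/
theorem dist_lt_of_φ₀_sub_ne_zero {x y : E3} (h : φ₀ (y - x) ≠ 0) : dist y x < 17 / 16 := by
  rw [dist_eq_norm]; exact norm_lt_of_φ₀_ne_zero h

/-- the derivative of the translated bump vanishes off the open `17/16`-ball as well (the bump is locally constant there). -/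
theorem fderiv_φ₀_eq_zero_of_lt_norm {y : E3} (hy : 17 / 16 < ‖y‖) : fderiv ℝ φ₀ y = 0 := by
  have hev : φ₀ =ᶠ[𝓝 y] fun _ => 0 := by
    have hopen : IsOpen {z : E3 | 17 / 16 < ‖z‖} := isOpen_lt continuous_const continuous_norm
    filter_upwards [hopen.mem_nhds hy] with z hz
    exact φ₀_eq_zero_of_le_norm (le_of_lt hz)
  rw [hev.fderiv_eq]
  exact fderiv_const_apply 0

end Bump

/-! ### XXIII.3 Local counts in separated sets -/

section Counts

variable {δ : ℝ} {S : Set E3}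

/-- ★ a `δ`-separated finite set has at most `(2r/δ + 1)³` members within distance `r` of any point `y`. -/
theorem card_filter_dist_le_le (hδ : 0 < δ) (hsep : IsSep δ S) (W : Finset E3) (hW : ↑W ⊆ S) (y : E3) {r : ℝ} (hr : 0 ≤ r) :
    ((W.filter fun x => dist x y ≤ r).card : ℝ) ≤ (2 * r / δ + 1) ^ 3 := by
  have h1 := card_le_of_separated_of_dist_le (W.filter fun x => dist x y ≤ r) y hδ hr
    (fun c hc => (Finset.mem_filter.1 hc).2)
    (fun c hc d hd hcd => hsep c (hW (Finset.mem_filter.1 hc).1) d (hW (Finset.mem_filter.1 hd).1) hcd)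
  rw [finrank_euclideanSpace_fin] at h1
  simpa using h1

/-- the strict-ball variant (`dist x y < r`), by monotonicity. -/
theorem card_filter_dist_lt_le (hδ : 0 < δ) (hsep : IsSep δ S) (W : Finset E3) (hW : ↑W ⊆ S) (y : E3) {r : ℝ} (hr : 0 ≤ r) :
    ((W.filter fun x => dist x y < r).card : ℝ) ≤ (2 * r / δ + 1) ^ 3 := by
  refine le_trans ?_ (card_filter_dist_le_le hδ hsep W hW y hr)
  exact_mod_cast Finset.card_le_card fun x hx => by
    simp only [Finset.mem_filter] at hx ⊢
    exact ⟨hx.1, hx.2.le⟩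

/-- a sum over the members within distance `r` of `y` of a nonnegative function, cubed, against the sum of cubes:
`(Σ_{x ∈ W, dist x y ≤ r} b x)³ ≤ ((2r/δ + 1)³)² · Σ_{x ∈ W, dist x y ≤ r} (b x)³`. -/
theorem sum_filter_pow_three_le (hδ : 0 < δ) (hsep : IsSep δ S) (W : Finset E3) (hW : ↑W ⊆ S) (y : E3) {r : ℝ} (hr : 0 ≤ r)
    {b : E3 → ℝ} (hb : ∀ x, 0 ≤ b x) :
    (∑ x ∈ W.filter (fun x => dist x y ≤ r), b x) ^ 3 ≤
      ((2 * r / δ + 1) ^ 3) ^ 2 * ∑ x ∈ W.filter (fun x => dist x y ≤ r), b x ^ 3 := by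
  have h1 := sum_pow_three_le_card_sq_mul_sum (W.filter fun x => dist x y ≤ r) (fun x _ => hb x)
  refine h1.trans (mul_le_mul_of_nonneg_right ?_ (Finset.sum_nonneg fun x _ => pow_nonneg (hb x) 3))
  have hc := card_filter_dist_le_le hδ hsep W hW y hr
  have hc0 : (0 : ℝ) ≤ ((W.filter fun x => dist x y ≤ r).card : ℝ) := by positivity
  exact pow_le_pow_left₀ hc0 hc 2

end Counts

end Summit.AtomisticToContinuum.Crystallization.Theorems.ChartedZeroExcessLayeredLatticeLiouville

end
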